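import Literature.Topology.FourManifolds.IntersectionNumbersReparam
import HarnessLib

/-!
# Intersection numbers under maps of the target manifold

Topic `Literature/Topology/FourManifolds` (proved API for `IntersectionNumbers.lean`; fact seat
`provefact-Literature.Topology.FourManifolds.Cobordism.Milnor1965_intersectionNumber_slab`).
Milnor, *Lectures on the h-cobordism theorem* (1965), §6: the intersection number `M' · M` of
Def. 6.1 (PDF p. 36) is a diffeomorphism invariant of the triple `(V; M, M')` — a positively
oriented frame of `T M` followed by one of `T M'` is carried by the differential of a
diffeomorphism `θ : V → V'` to such frames of `θ(M)`, `θ(M')`, and it is positively oriented in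
`T V'` iff `θ` preserves the orientations; this is used tacitly whenever a level of a cobordism is
moved along the trajectories of a gradient-like field (Thm. 3.4, PDF p. 13: *"`f⁻¹[a, b]` is
diffeomorphic to `f⁻¹(a) × [a, b]`"*; proof of Thm. 6.4, PDF p. 39: *"the trajectories of `ξ`
determine a diffeomorphism of `V₀ - S_L` onto `V - S_R`"*) or read in a chart.  In the language of
maps (`Literature.Topology.FourManifolds.intersectionNumber`: `s : A → X`, `p : B → X` of
complementary dimensions, orientations `oA`, `oB`, `oX`): post-composing both maps with
`θ : X → X'` multiplies every crossing matrix on the left by the matrix of `dθ`, so the local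
sign at a double point is unchanged when `dθ` there carries `oX` to `oX'` (and changes sign when it
does not), and `(θ ∘ s) · (θ ∘ p) = s · p` for an injective orientation-preserving `θ` with
invertible differential (the companion of `IntersectionNumbersReparam.lean`, which reparametrises
a source).  Everything here is proved:

* `Literature.Topology.FourManifolds.crossingMatrix_comp_target` — `[T u | T w] = T · [u | w]`,
  and `det_crossingMatrix_comp_target`;
* `Literature.Topology.FourManifolds.det_crossingMatrixAt_comp_target` — the chain rule read on
  crossing matrices at a double point; `mapsTransverseAt_comp_target_iff`,
  `mapsTransverse_comp_target_iff`;
* `Literature.Topology.FourManifolds.localIntersectionSign_comp_target` — the local sign of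
  `(θ ∘ s, θ ∘ p)` at a double point equals that of `(s, p)` when `dθ` carries `oX` to `oX'`
  there (the pointwise clause of `Literature.Topology.FourManifolds.IsOrientationPreserving`),
  and `localIntersectionSign_comp_target_of_neg` (minus it when `dθ` carries `oX` to `-oX'`);
* `Literature.Topology.FourManifolds.doublePoints_comp_target` — for injective `θ` the double
  points are the same;
* `Literature.Topology.FourManifolds.intersectionNumber_comp_target_of_isOrientationPreserving` /
  `…_of_isOrientationReversing` — `(θ ∘ s) · (θ ∘ p) = ± s · p`; and the versions for a
  diffeomorphism `θ : X ≃ₘ X'` (`intersectionNumber_comp_diffeomorph_target_of_…`).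

## References

* J. Milnor, *Lectures on the h-cobordism theorem*, Princeton (1965), §6 Def. 6.1 and Remark 2
  (PDF p. 36), Thm. 3.4 (PDF p. 13), proof of Thm. 6.4 (PDF p. 39). [MilnorHCobordism1965]
* M. W. Hirsch, *Differential Topology*, GTM 33 (1976), §4.4. [HirschDT1976]
-/

open scoped Manifold ContDiff Topology
open Set Module Function

noncomputable section

namespace Literature.Topology.FourManifolds

/-! ### Linear algebra: composing both blocks with an endomorphism of the target -/

section LinearAlgebra

variable {a b n : ℕ}

/-- Composing both maps with an endomorphism `T` of `ℝⁿ` multiplies the crossing matrix on the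
left by the matrix of `T`: `[T u | T w] = T · [u | w]`. [folklore] -/
theorem crossingMatrix_comp_target (h : a + b = n)
    (T : EuclideanSpace ℝ (Fin n) →ₗ[ℝ] EuclideanSpace ℝ (Fin n))
    (u : EuclideanSpace ℝ (Fin a) →ₗ[ℝ] EuclideanSpace ℝ (Fin n))
    (w : EuclideanSpace ℝ (Fin b) →ₗ[ℝ] EuclideanSpace ℝ (Fin n)) :
    crossingMatrix h (T ∘ₗ u) (T ∘ₗ w) =
      LinearMap.toMatrix (euclideanStdBasis n) (euclideanStdBasis n) T * crossingMatrix h u w := by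
  have hc : (T ∘ₗ u).coprod (T ∘ₗ w) = T ∘ₗ (u.coprod w) := by
    ext v <;> simp
  unfold crossingMatrix
  rw [hc, LinearMap.toMatrix_comp ((euclideanStdBasis a).prod (euclideanStdBasis b))
    (euclideanStdBasis n) (euclideanStdBasis n)]
  simp only [Matrix.reindex_apply, Equiv.refl_symm, Equiv.coe_refl]
  rw [Matrix.submatrix_mul _ _ _ id _ bijective_id, Matrix.submatrix_id_id]

/-- `det [T u | T w] = det T · det [u | w]`. [folklore] -/
theorem det_crossingMatrix_comp_target (h : a + b = n)
    (T : EuclideanSpace ℝ (Fin n) →ₗ[ℝ] EuclideanSpace ℝ (Fin n))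
    (u : EuclideanSpace ℝ (Fin a) →ₗ[ℝ] EuclideanSpace ℝ (Fin n))
    (w : EuclideanSpace ℝ (Fin b) →ₗ[ℝ] EuclideanSpace ℝ (Fin n)) :
    (crossingMatrix h (T ∘ₗ u) (T ∘ₗ w)).det = LinearMap.det T * (crossingMatrix h u w).det := by
  rw [crossingMatrix_comp_target, Matrix.det_mul, LinearMap.det_toMatrix]

end LinearAlgebra

/-! ### Post-composing with a map of the target -/

section Target

variable {a b n : ℕ}
  {HA : Type*} [TopologicalSpace HA] {IA : ModelWithCorners ℝ (EuclideanSpace ℝ (Fin a)) HA}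
  {HB : Type*} [TopologicalSpace HB] {IB : ModelWithCorners ℝ (EuclideanSpace ℝ (Fin b)) HB}
  {HX : Type*} [TopologicalSpace HX] {IX : ModelWithCorners ℝ (EuclideanSpace ℝ (Fin n)) HX}
  {HX' : Type*} [TopologicalSpace HX'] {IX' : ModelWithCorners ℝ (EuclideanSpace ℝ (Fin n)) HX'}
  {A : Type*} [TopologicalSpace A] [ChartedSpace HA A]
  {B : Type*} [TopologicalSpace B] [ChartedSpace HB B]
  {X : Type*} [TopologicalSpace X] [ChartedSpace HX X]
  {X' : Type*} [TopologicalSpace X'] [ChartedSpace HX' X']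

/-- **The chain rule on crossing matrices, target side**: at a double point `s x = p y`, for
`θ : X → X'` differentiable at `s x` and `s`, `p` differentiable at `x`, `y`,
`det [d(θ ∘ s)_x | d(θ ∘ p)_y] = det dθ_{s x} · det [ds_x | dp_y]`. [folklore] -/
theorem det_crossingMatrixAt_comp_target (h : a + b = n) {s : A → X} {p : B → X} {θ : X → X'}
    {x : A} {y : B} (hxy : s x = p y) (hθ : MDifferentiableAt IX IX' θ (s x))
    (hs : MDifferentiableAt IA IX s x) (hp : MDifferentiableAt IB IX p y) :
    (crossingMatrixAt IA IB IX' h (θ ∘ s) (θ ∘ p) x y).det =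
      LinearMap.det (M := EuclideanSpace ℝ (Fin n)) (mfderiv IX IX' θ (s x)).toLinearMap *
        (crossingMatrixAt IA IB IX h s p x y).det := by
  unfold crossingMatrixAt
  have hθ' : MDifferentiableAt IX IX' θ (p y) := hxy ▸ hθ
  rw [mfderiv_comp x hθ hs, mfderiv_comp y hθ' hp, ← hxy]
  exact det_crossingMatrix_comp_target h _ _ _

/-- Transversality at a double point is invariant under post-composition with a map of the
target whose differential there is invertible. [folklore] -/
theorem mapsTransverseAt_comp_target_iff (h : a + b = n) {s : A → X} {p : B → X} {θ : X → X'}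
    {x : A} {y : B} (hxy : s x = p y) (hθ : MDifferentiableAt IX IX' θ (s x))
    (hs : MDifferentiableAt IA IX s x) (hp : MDifferentiableAt IB IX p y)
    (hdet : LinearMap.det (M := EuclideanSpace ℝ (Fin n)) (mfderiv IX IX' θ (s x)).toLinearMap ≠ 0) :
    MapsTransverseAt IA IB IX' h (θ ∘ s) (θ ∘ p) x y ↔ MapsTransverseAt IA IB IX h s p x y := by
  unfold MapsTransverseAt
  rw [det_crossingMatrixAt_comp_target h hxy hθ hs hp]
  exact ⟨fun H H0 => H (by rw [H0, mul_zero]), fun H => mul_ne_zero hdet H⟩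

omit [TopologicalSpace A] [TopologicalSpace B] [ChartedSpace HA A] [ChartedSpace HB B]
  [TopologicalSpace X] [ChartedSpace HX X] [TopologicalSpace X'] [ChartedSpace HX' X'] in
/-- For an injective map of the target the double points of `(θ ∘ s, θ ∘ p)` are those of
`(s, p)`. [folklore] -/
theorem doublePoints_comp_target {s : A → X} {p : B → X} {θ : X → X'} (hθ : Injective θ) :
    doublePoints (θ ∘ s) (θ ∘ p) = doublePoints s p := by
  ext q
  exact hθ.eq_iff

/-- **Transversality is invariant under an injective map of the target with invertible
differential** (`s`, `p` differentiable). [folklore] -/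
theorem mapsTransverse_comp_target_iff (h : a + b = n) {s : A → X} {p : B → X} {θ : X → X'}
    (hθi : Injective θ) (hθ : MDifferentiable IX IX' θ) (hs : MDifferentiable IA IX s)
    (hp : MDifferentiable IB IX p)
    (hdet : ∀ v, LinearMap.det (M := EuclideanSpace ℝ (Fin n)) (mfderiv IX IX' θ v).toLinearMap ≠ 0) :
    MapsTransverse IA IB IX' h (θ ∘ s) (θ ∘ p) ↔ MapsTransverse IA IB IX h s p := by
  constructor
  · intro H x y hxy
    exact (mapsTransverseAt_comp_target_iff h hxy (hθ _) (hs x) (hp y) (hdet _)).1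
      (H x y (congrArg θ hxy))
  · intro H x y hxy
    have hxy' : s x = p y := hθi hxy
    exact (mapsTransverseAt_comp_target_iff h hxy' (hθ _) (hs x) (hp y) (hdet _)).2 (H x y hxy')

variable [IsManifold IA 1 A] [IsManifold IB 1 B] [IsManifold IX 1 X] [IsManifold IX' 1 X']

/-- **Local signs under a map of the target carrying the orientation** (Milnor 1965, Def. 6.1;
Hirsch §4.4): at a double point `v = s x = p y`, if `dθ_v` is invertible and carries `oX v` to
`oX' (θ v)` — i.e. `oX' (θ v) = oX v` (both read in the preferred charts) exactly when
`det dθ_v > 0`, the pointwise clause of `Literature.Topology.FourManifolds.IsOrientationPreserving`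
— then the local intersection sign of `(θ ∘ s, θ ∘ p)` at `(x, y)` with respect to `oX'` equals
that of `(s, p)` with respect to `oX`: the crossing matrix is multiplied by `dθ_v`
(`det_crossingMatrixAt_comp_target`) and the orientation character of the target changes by the
sign of `det dθ_v`. [cite: MilnorHCobordism1965, Def. 6.1 (PDF p. 36); HirschDT1976, §4.4] -/
theorem localIntersectionSign_comp_target (h : a + b = n) (oA : SmoothOrientation IA A)
    (oB : SmoothOrientation IB B) {oX : SmoothOrientation IX X} {oX' : SmoothOrientation IX' X'}
    {s : A → X} {p : B → X} {θ : X → X'} {x : A} {y : B} (hxy : s x = p y)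
    (hθ : MDifferentiableAt IX IX' θ (s x)) (hs : MDifferentiableAt IA IX s x)
    (hp : MDifferentiableAt IB IX p y)
    (hdet : LinearMap.det (M := EuclideanSpace ℝ (Fin n)) (mfderiv IX IX' θ (s x)).toLinearMap ≠ 0)
    (hor : oX' (θ (s x)) = oX (s x) ↔
      0 < LinearMap.det (M := EuclideanSpace ℝ (Fin n)) (mfderiv IX IX' θ (s x)).toLinearMap) :
    localIntersectionSign IA IB IX' h oA oB oX' (θ ∘ s) (θ ∘ p) x y =
      localIntersectionSign IA IB IX h oA oB oX s p x y := by
  unfold localIntersectionSign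
  rw [det_crossingMatrixAt_comp_target h hxy hθ hs hp, sign_mul, SignType.coe_mul,
    Function.comp_apply]
  have key : (SignType.sign (LinearMap.det (M := EuclideanSpace ℝ (Fin n))
      (mfderiv IX IX' θ (s x)).toLinearMap) : ℤ) * orientationSign (oX' (θ (s x))) =
      orientationSign (oX (s x)) := by
    rcases lt_or_gt_of_ne hdet with hlt | hgt
    · have hne : oX (s x) ≠ oX' (θ (s x)) := fun he => absurd (hor.1 he.symm) (not_lt.2 hlt.le)
      rw [sign_neg hlt, orientationSign_eq_neg_of_ne hne]
      simp
    · rw [sign_pos hgt, hor.2 hgt]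
      simp
  rw [← key]
  ring

/-- **Local signs under a map of the target reversing the orientation** at the double point
(`oX' (θ v) = -oX v` exactly when `det dθ_v > 0`): the local sign changes sign.
[cite: MilnorHCobordism1965, §6 Remark 2 (PDF p. 36); HirschDT1976, §4.4] -/
theorem localIntersectionSign_comp_target_of_neg (h : a + b = n) (oA : SmoothOrientation IA A)
    (oB : SmoothOrientation IB B) {oX : SmoothOrientation IX X} {oX' : SmoothOrientation IX' X'}
    {s : A → X} {p : B → X} {θ : X → X'} {x : A} {y : B} (hxy : s x = p y)
    (hθ : MDifferentiableAt IX IX' θ (s x)) (hs : MDifferentiableAt IA IX s x)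
    (hp : MDifferentiableAt IB IX p y)
    (hdet : LinearMap.det (M := EuclideanSpace ℝ (Fin n)) (mfderiv IX IX' θ (s x)).toLinearMap ≠ 0)
    (hor : (-oX') (θ (s x)) = oX (s x) ↔
      0 < LinearMap.det (M := EuclideanSpace ℝ (Fin n)) (mfderiv IX IX' θ (s x)).toLinearMap) :
    localIntersectionSign IA IB IX' h oA oB oX' (θ ∘ s) (θ ∘ p) x y =
      -localIntersectionSign IA IB IX h oA oB oX s p x y := by
  rw [← localIntersectionSign_comp_target h oA oB hxy hθ hs hp hdet hor,
    localIntersectionSign_neg_target, neg_neg]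

/-- **Intersection numbers under an orientation-preserving map of the target** (Milnor 1965,
Def. 6.1: the intersection number is an invariant of the oriented triple `(V; M, M')`): for an
injective `θ : X → X'`, differentiable with invertible differential and preserving the
orientations `oX`, `oX'` (`Literature.Topology.FourManifolds.IsOrientationPreserving`), and `s`,
`p` differentiable, `(θ ∘ s) · (θ ∘ p) = s · p`. [cite: MilnorHCobordism1965, Def. 6.1 and Remark 2 (PDF p. 36); HirschDT1976, §4.4] -/
theorem intersectionNumber_comp_target_of_isOrientationPreserving (h : a + b = n)
    (oA : SmoothOrientation IA A) (oB : SmoothOrientation IB B) {oX : SmoothOrientation IX X}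
    {oX' : SmoothOrientation IX' X'} {s : A → X} {p : B → X} {θ : X → X'}
    (hor : IsOrientationPreserving oX oX' θ) (hθi : Injective θ) (hθ : MDifferentiable IX IX' θ)
    (hs : MDifferentiable IA IX s) (hp : MDifferentiable IB IX p)
    (hdet : ∀ v, LinearMap.det (M := EuclideanSpace ℝ (Fin n)) (mfderiv IX IX' θ v).toLinearMap ≠ 0) :
    intersectionNumber IA IB IX' h oA oB oX' (θ ∘ s) (θ ∘ p) =
      intersectionNumber IA IB IX h oA oB oX s p := by
  unfold intersectionNumber
  rw [doublePoints_comp_target hθi]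
  refine finsum_mem_congr rfl fun q hq => ?_
  exact localIntersectionSign_comp_target h oA oB (mem_doublePoints.1 hq) (hθ _) (hs _) (hp _)
    (hdet _) (hor _)

/-- **Intersection numbers under an orientation-reversing map of the target**: with `θ` as
above but reversing the orientations, `(θ ∘ s) · (θ ∘ p) = -(s · p)`.
[cite: MilnorHCobordism1965, §6 Remark 2 (PDF p. 36); HirschDT1976, §4.4] -/
theorem intersectionNumber_comp_target_of_isOrientationReversing (h : a + b = n)
    (oA : SmoothOrientation IA A) (oB : SmoothOrientation IB B) {oX : SmoothOrientation IX X}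
    {oX' : SmoothOrientation IX' X'} {s : A → X} {p : B → X} {θ : X → X'}
    (hor : IsOrientationReversing oX oX' θ) (hθi : Injective θ) (hθ : MDifferentiable IX IX' θ)
    (hs : MDifferentiable IA IX s) (hp : MDifferentiable IB IX p)
    (hdet : ∀ v, LinearMap.det (M := EuclideanSpace ℝ (Fin n)) (mfderiv IX IX' θ v).toLinearMap ≠ 0) :
    intersectionNumber IA IB IX' h oA oB oX' (θ ∘ s) (θ ∘ p) =
      -intersectionNumber IA IB IX h oA oB oX s p := by
  rw [isOrientationReversing_iff] at hor
  rw [← intersectionNumber_comp_target_of_isOrientationPreserving h oA oB hor hθi hθ hs hp hdet,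
    intersectionNumber_neg_target, neg_neg]

end Target

/-! ### Diffeomorphisms of the target -/

section Diffeomorph

variable {a b n : ℕ}
  {HA : Type*} [TopologicalSpace HA] {IA : ModelWithCorners ℝ (EuclideanSpace ℝ (Fin a)) HA}
  {HB : Type*} [TopologicalSpace HB] {IB : ModelWithCorners ℝ (EuclideanSpace ℝ (Fin b)) HB}
  {HX : Type*} [TopologicalSpace HX] {IX : ModelWithCorners ℝ (EuclideanSpace ℝ (Fin n)) HX}
  {HX' : Type*} [TopologicalSpace HX'] {IX' : ModelWithCorners ℝ (EuclideanSpace ℝ (Fin n)) HX'}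
  {A : Type*} [TopologicalSpace A] [ChartedSpace HA A]
  {B : Type*} [TopologicalSpace B] [ChartedSpace HB B]
  {X : Type*} [TopologicalSpace X] [ChartedSpace HX X]
  {X' : Type*} [TopologicalSpace X'] [ChartedSpace HX' X']

/-- **Transversality under a diffeomorphism of the target**: `(θ ∘ s, θ ∘ p)` is transverse iff
`(s, p)` is (`s`, `p` differentiable). [folklore] -/
theorem mapsTransverse_comp_diffeomorph_target_iff (h : a + b = n) {s : A → X} {p : B → X}
    (θ : X ≃ₘ⟮IX, IX'⟯ X') (hs : MDifferentiable IA IX s) (hp : MDifferentiable IB IX p) :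
    MapsTransverse IA IB IX' h (θ ∘ s) (θ ∘ p) ↔ MapsTransverse IA IB IX h s p :=
  mapsTransverse_comp_target_iff h θ.injective (θ.mdifferentiable (by simp)) hs hp
    (Diffeomorph.det_mfderiv_ne_zero θ)

variable [IsManifold IA 1 A] [IsManifold IB 1 B] [IsManifold IX 1 X] [IsManifold IX' 1 X']

/-- **Intersection numbers under an orientation-preserving diffeomorphism of the target**
(Milnor 1965, Def. 6.1): `(θ ∘ s) · (θ ∘ p) = s · p`. [cite: MilnorHCobordism1965, Def. 6.1 and Remark 2 (PDF p. 36)] -/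
theorem intersectionNumber_comp_diffeomorph_target_of_isOrientationPreserving (h : a + b = n)
    (oA : SmoothOrientation IA A) (oB : SmoothOrientation IB B) {oX : SmoothOrientation IX X}
    {oX' : SmoothOrientation IX' X'} {s : A → X} {p : B → X} (θ : X ≃ₘ⟮IX, IX'⟯ X')
    (hor : θ.IsOrientationPreserving oX oX') (hs : MDifferentiable IA IX s)
    (hp : MDifferentiable IB IX p) :
    intersectionNumber IA IB IX' h oA oB oX' (θ ∘ s) (θ ∘ p) =
      intersectionNumber IA IB IX h oA oB oX s p :=
  intersectionNumber_comp_target_of_isOrientationPreserving h oA oB hor θ.injective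
    (θ.mdifferentiable (by simp)) hs hp (Diffeomorph.det_mfderiv_ne_zero θ)

/-- **Intersection numbers under an orientation-reversing diffeomorphism of the target**:
`(θ ∘ s) · (θ ∘ p) = -(s · p)`. [cite: MilnorHCobordism1965, §6 Remark 2 (PDF p. 36)] -/
theorem intersectionNumber_comp_diffeomorph_target_of_isOrientationReversing (h : a + b = n)
    (oA : SmoothOrientation IA A) (oB : SmoothOrientation IB B) {oX : SmoothOrientation IX X}
    {oX' : SmoothOrientation IX' X'} {s : A → X} {p : B → X} (θ : X ≃ₘ⟮IX, IX'⟯ X')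
    (hor : θ.IsOrientationReversing oX oX') (hs : MDifferentiable IA IX s)
    (hp : MDifferentiable IB IX p) :
    intersectionNumber IA IB IX' h oA oB oX' (θ ∘ s) (θ ∘ p) =
      -intersectionNumber IA IB IX h oA oB oX s p :=
  intersectionNumber_comp_target_of_isOrientationReversing h oA oB hor θ.injective
    (θ.mdifferentiable (by simp)) hs hp (Diffeomorph.det_mfderiv_ne_zero θ)

end Diffeomorph

end Literature.Topology.FourManifolds

end
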